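import Mathlib
import Literature.Analysis.FluidPDE.ClassicalSolution
import Literature.Analysis.FluidPDE.ClassicalSolutionCalculus
import Literature.Analysis.FluidPDE.LerayHopf
import Literature.Analysis.FluidPDE.NSWave0
import Literature.Analysis.FluidPDE.SuitableWeak
import Summits.NavierStokesRegularity.NavierStokesRegularity.Theses.L3TimeExponentPincer
import Summits.NavierStokesRegularity.NavierStokesRegularity.Theorems.L3TimeExponentPincerJawSuperEuler
import Summits.NavierStokesRegularity.NavierStokesRegularity.Theorems.L3TimeExponentPincerJawFarFieldLocal
import Summits.NavierStokesRegularity.NavierStokesRegularity.Theorems.L3TimeExponentPincerJawFarFieldLocalHolds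
import Summits.NavierStokesRegularity.NavierStokesRegularity.Theorems.L3TimeExponentPincerEffSatBlowupStubParabolicConcentrationBlowup
import HarnessLib

/-!
# The finest position localisation of crux `L3CascadeJaw` (stmt-NavierStokesRegularity-19499): the jaw is
# decided in every neighbourhood of the time-`T` singular set

Support file (cell ns-regularity-ideate, seat ns-pincer-19499-p1 g2), sequel of `…JawFarFieldLocal` (p478152)
and `…JawFarFieldLocalHolds` (far-field bound of the frame, `farFieldBound_of_frame`).  Let
`Σ_T = {x : (T,x) is not a regular point of u}` (CKN: `IsRegularPoint u (T,x)` iff `u` is essentially bounded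
on a centred parabolic cylinder around `(T,x)`).  For a frame solution and any `ε > 0`, `u` is BOUNDED near `T`
off the `ε`-neighbourhood `thickening ε Σ_T`: off a large ball by the far-field theorem, and on the compact set
`B̄(0,R) ∖ thickening ε Σ_T` of regular points by finitely many cylinder bounds (the compactness pattern of
Lemarié-Rieusset 2016, proof of Thm 15.1 (C), p. 566 / Rusin–Šverák 2011 §4, as in the tree's
`exists_pos_eLpNorm_lt_top_of_forall_exists_cylinder`), made pointwise by joint continuity.  Hence the
super-Euler-speed set lies in `thickening ε Σ_T` near `T`, and (speed localisation, p471620):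

* `jawClauseAt_iff_local_of_bound_off` — general form of p478152's lemma: a bound `|u| ≤ B` off ANY set `N` on a
  final window makes the clause at `q < 5` equivalent to the local clause on `N`;
* `exists_bound_near_regularPoint`, `bound_off_thickening_singularSet_of_frame` — the pointwise bounds;
* `jawClauseAt_iff_local_singularSet` — for every frame solution, `ε > 0`, `0 ≤ q < 5`: the clause at `q` ⟺
  `∫_{T₂}^T (∫_{thickening ε Σ_T} |u(t)|³)^{q/3} dt < ∞` on a final window;
* `l3CascadeJaw_iff_local_singularSet` — the crux BY NAME ⟺ this form: **the jaw is a property of the germ of the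
  solution at its time-`T` singular set** (the finest possible position localisation: at regular points `u` is
  locally bounded, so nothing outside `Σ_T`'s neighbourhoods can matter; by CKN `Σ_T` is compact with `𝓗¹(Σ_T) = 0`).

WHAT THIS IS NOT: not a claim about Navier–Stokes regularity or blow-up and no progress on the crux's open
content; landed `--supports stmt-NavierStokesRegularity-19499`.
-/

noncomputable section

namespace Summit.NavierStokesRegularity.NavierStokesRegularity.Theorems.L3TimeExponentPincerJawSingularSetLocal

open MeasureTheory Set Function Filter Metric Topology
open scoped ENNReal NNReal
open Literature.Analysis.FluidPDE
open Summit.NavierStokesRegularity.NavierStokesRegularity.Theses.L3TimeExponentPincer (L3CascadeJaw)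
open Summit.NavierStokesRegularity.NavierStokesRegularity.Theorems.L3TimeExponentPincerJawFullMorrey
  (eLpNorm_three_rpow_eq)
open Summit.NavierStokesRegularity.NavierStokesRegularity.Theorems.L3TimeExponentPincerJawSuperEuler
  (jawClauseAt_iff_superEuler)
open Summit.NavierStokesRegularity.NavierStokesRegularity.Theorems.L3TimeExponentPincerJawFarFieldLocal
  (lt_eulerThreshold_of_close)
open Summit.NavierStokesRegularity.NavierStokesRegularity.Theorems.L3TimeExponentPincerJawFarFieldLocalHolds
  (farFieldBound_of_frame)
open Summit.NavierStokesRegularity.NavierStokesRegularity.Theorems.L3TimeExponentPincerStubParabolicConcentration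
  (norm_le_of_ae_bound_of_continuousOn)

/-! ## §1  Speed localisation relative to an arbitrary set -/

/-- If `|v| ≤ B` off `N` and `B < λ`, then `{|v| > λ} ⊆ N`. [folklore] -/
theorem superLevel_subset_of_bound_off {v : EuclideanSpace ℝ (Fin 3) → EuclideanSpace ℝ (Fin 3)}
    {N : Set (EuclideanSpace ℝ (Fin 3))} {B l : ℝ}
    (hoff : ∀ x, x ∉ N → ‖v x‖ ≤ B) (hl : B < l) :
    {y | l < ‖v y‖} ⊆ N := by
  intro y hy
  by_contra hN
  exact absurd ((hoff y hN).trans_lt hl) (not_lt.2 (le_of_lt hy))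

/-- **Localisation of the clause to any set off which the field is bounded near `T`.**  For a frame solution
with `|u(t,x)| ≤ B` for `x ∉ N`, `t ∈ (T₁,T)`, and `0 ≤ q < 5`: `∫_{T₂}^T ‖u(t)‖₃^q dt < ∞` on some final window
⟺ `∫_{T₂}^T (∫_N |u(t)|³)^{q/3} dt < ∞` on some final window. -/
theorem jawClauseAt_iff_local_of_bound_off {ν T : ℝ} (hν : 0 < ν)
    {u : ℝ → EuclideanSpace ℝ (Fin 3) → EuclideanSpace ℝ (Fin 3)} {p : ℝ → EuclideanSpace ℝ (Fin 3) → ℝ}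
    (hcl : IsClassicalNSSolutionOn (Ico 0 T) ν 0 u p) (hLH : IsLerayHopfOn T ν 0 (u 0) u)
    {N : Set (EuclideanSpace ℝ (Fin 3))} {B T₁ : ℝ} (hB : 0 ≤ B) (hT₁ : T₁ < T)
    (hoff : ∀ t ∈ Ioo T₁ T, ∀ x, x ∉ N → ‖u t x‖ ≤ B)
    {q : ℝ} (hq0 : 0 ≤ q) (hq5 : q < 5) :
    (∃ T₂ ∈ Ioo 0 T, (∫⁻ t in Ioo T₂ T, eLpNorm (u t) 3 volume ^ q) < ⊤) ↔
      ∃ T₂ ∈ Ioo 0 T, (∫⁻ t in Ioo T₂ T, (∫⁻ x in N, ‖u t x‖ₑ ^ 3) ^ (q / 3)) < ⊤ := by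
  have hq3 : 0 ≤ q / 3 := by positivity
  constructor
  · rintro ⟨T₂, hT₂, hfin⟩
    refine ⟨T₂, hT₂, lt_of_le_of_lt (lintegral_mono fun t => ?_) hfin⟩
    rw [eLpNorm_three_rpow_eq]
    exact ENNReal.rpow_le_rpow (setLIntegral_le_lintegral _ _) hq3
  · rintro ⟨T₂, hT₂, hfin⟩
    refine (jawClauseAt_iff_superEuler hν hcl hLH zero_le_one (le_refl (3 / 5 : ℝ)) hq0 hq5).2 ?_
    have hδ : 0 < (B + 1) ^ (-(5 / 3 : ℝ)) := Real.rpow_pos_of_pos (by linarith) _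
    set T₃ : ℝ := max (max T₂ T₁) (T - (B + 1) ^ (-(5 / 3 : ℝ))) with hT₃
    have hT₃mem : T₃ ∈ Ioo 0 T :=
      ⟨lt_max_of_lt_left (lt_max_of_lt_left hT₂.1), max_lt (max_lt hT₂.2 hT₁) (by linarith)⟩
    refine ⟨T₃, hT₃mem, ?_⟩
    have hsub : ∀ t ∈ Ioo T₃ T,
        (∫⁻ x in {y | 1 * (T - t) ^ (-(3 / 5 : ℝ)) < ‖u t y‖}, ‖u t x‖ₑ ^ 3) ^ (q / 3) ≤
          (∫⁻ x in N, ‖u t x‖ₑ ^ 3) ^ (q / 3) := by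
      intro t ht
      have ht₁ : t ∈ Ioo T₁ T := ⟨((le_max_right _ _).trans (le_max_left _ _)).trans_lt ht.1, ht.2⟩
      have hclose : T - t < (B + 1) ^ (-(5 / 3 : ℝ)) := by
        have := (le_max_right (max T₂ T₁) (T - (B + 1) ^ (-(5 / 3 : ℝ)))).trans_lt ht.1
        linarith
      exact ENNReal.rpow_le_rpow (lintegral_mono_set
        (superLevel_subset_of_bound_off (hoff t ht₁) (lt_eulerThreshold_of_close hB ht.2 hclose))) hq3
    calc ∫⁻ t in Ioo T₃ T, (∫⁻ x in {y | 1 * (T - t) ^ (-(3 / 5 : ℝ)) < ‖u t y‖}, ‖u t x‖ₑ ^ 3) ^ (q / 3)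
        ≤ ∫⁻ t in Ioo T₃ T, (∫⁻ x in N, ‖u t x‖ₑ ^ 3) ^ (q / 3) := setLIntegral_mono' measurableSet_Ioo hsub
      _ ≤ ∫⁻ t in Ioo T₂ T, (∫⁻ x in N, ‖u t x‖ₑ ^ 3) ^ (q / 3) :=
          lintegral_mono_set (Ioo_subset_Ioo_left ((le_max_left _ _).trans (le_max_left _ _)))
      _ < ⊤ := hfin

/-! ## §2  Pointwise bounds: near a regular point, and off a neighbourhood of the singular set -/

/-- **Near a regular point `(T,x)` a frame solution is pointwise bounded**: there are `r > 0` and `M` with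
`|u(t,y)| ≤ M` for `t ∈ (T - r², T)`, `t > 0`, `y ∈ B(x,r)` (essential bound on the centred cylinder + joint
continuity of the classical field). -/
theorem exists_bound_near_regularPoint {ν T : ℝ}
    {u : ℝ → EuclideanSpace ℝ (Fin 3) → EuclideanSpace ℝ (Fin 3)} {p : ℝ → EuclideanSpace ℝ (Fin 3) → ℝ}
    (hcl : IsClassicalNSSolutionOn (Ico 0 T) ν 0 u p) {x : EuclideanSpace ℝ (Fin 3)}
    (hx : IsRegularPoint u (T, x)) :
    ∃ r : ℝ, 0 < r ∧ ∃ M : ℝ, ∀ t ∈ Ioo (T - r ^ 2) T, 0 < t → ∀ y ∈ ball x r, ‖u t y‖ ≤ M := by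
  obtain ⟨r, hr, hfin⟩ := hx
  set C : Set (ℝ × EuclideanSpace ℝ (Fin 3)) := parabolicCylinderCentered r ((T, x) : ℝ × EuclideanSpace ℝ (Fin 3))
    with hC
  set O : Set (ℝ × EuclideanSpace ℝ (Fin 3)) := C ∩ (Ioo 0 T ×ˢ (univ : Set (EuclideanSpace ℝ (Fin 3)))) with hO
  have hOopen : IsOpen O := (isOpen_parabolicCylinderCentered r _).inter (isOpen_Ioo.prod isOpen_univ)
  have hOsub : O ⊆ Ico 0 T ×ˢ (univ : Set (EuclideanSpace ℝ (Fin 3))) :=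
    fun z hz => ⟨⟨hz.2.1.1.le, hz.2.1.2⟩, mem_univ _⟩
  have hcont : ContinuousOn (uncurry u) O := hcl.smooth_velocity.continuousOn.mono hOsub
  set E : ℝ≥0∞ := eLpNorm (uncurry u) ∞ (volume.restrict C) with hE
  have hEtop : E ≠ ⊤ := hfin.ne
  have hae' : ∀ᵐ z ∂(volume.restrict C), ‖uncurry u z‖ ≤ E.toReal := by
    filter_upwards [ae_le_eLpNormEssSup (μ := volume.restrict C) (f := uncurry u)] with z hz
    have hz' : ‖uncurry u z‖ₑ ≤ E := by rwa [hE, eLpNorm_exponent_top]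
    have := ENNReal.toReal_mono hEtop hz'
    rwa [toReal_enorm] at this
  have hae : ∀ᵐ z ∂(volume.restrict O), ‖uncurry u z‖ ≤ E.toReal :=
    ae_restrict_of_ae_restrict_of_subset inter_subset_left hae'
  have hbound := norm_le_of_ae_bound_of_continuousOn hOopen hcont hae
  refine ⟨r, hr, E.toReal, fun t ht ht0 y hy => hbound (t, y) ⟨?_, ⟨ht0, ht.2⟩, mem_univ _⟩⟩
  rw [hC, mem_parabolicCylinderCentered]
  exact ⟨⟨ht.1, by nlinarith [ht.2, sq_nonneg r]⟩, mem_ball.1 hy⟩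

/-- **Off every neighbourhood of the time-`T` singular set a frame solution is bounded near `T`.**  For a frame
solution and `ε > 0` there are `B ≥ 0` and `T₁ < T` with `|u(t,x)| ≤ B` for all `t ∈ (T₁,T)` and all `x` outside
`thickening ε {y : ¬ IsRegularPoint u (T,y)}` (far-field bound + compactness of `B̄(0,R) ∖ thickening ε Σ_T` +
finitely many cylinder bounds). [cite: LemarieRieusset2016, Thm. 15.1 (C), proof p. 566] -/
theorem bound_off_thickening_singularSet_of_frame {ν T : ℝ} (hν : 0 < ν) (hT : 0 < T)
    {u : ℝ → EuclideanSpace ℝ (Fin 3) → EuclideanSpace ℝ (Fin 3)} {p : ℝ → EuclideanSpace ℝ (Fin 3) → ℝ}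
    (hcl : IsClassicalNSSolutionOn (Ico 0 T) ν 0 u p) (hLH : IsLerayHopfOn T ν 0 (u 0) u)
    (hdec : HasRapidSpatialDecay (u 0)) {ε : ℝ} (hε : 0 < ε) :
    ∃ B T₁ : ℝ, 0 ≤ B ∧ T₁ < T ∧ ∀ t ∈ Ioo T₁ T, ∀ x,
      x ∉ thickening ε {y | ¬ IsRegularPoint u ((T, y) : ℝ × EuclideanSpace ℝ (Fin 3))} → ‖u t x‖ ≤ B := by
  obtain ⟨R, B₀, T₀, hB₀, hT₀, hfar⟩ := farFieldBound_of_frame hν hT hcl hLH hdec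
  set Sg : Set (EuclideanSpace ℝ (Fin 3)) := {y | ¬ IsRegularPoint u ((T, y) : ℝ × EuclideanSpace ℝ (Fin 3))}
    with hSg
  set K : Set (EuclideanSpace ℝ (Fin 3)) := closedBall (0 : EuclideanSpace ℝ (Fin 3)) R ∩ (thickening ε Sg)ᶜ
    with hK
  have hKc : IsCompact K := (isCompact_closedBall _ _).inter_right isOpen_thickening.isClosed_compl
  -- every point of `K` is regular: local cylinder bounds
  have hreg : ∀ x ∈ K, IsRegularPoint u ((T, x) : ℝ × EuclideanSpace ℝ (Fin 3)) := by
    intro x hx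
    by_contra hnot
    exact hx.2 (mem_thickening_iff.2 ⟨x, hnot, by rw [dist_self]; exact hε⟩)
  have hloc : ∀ x : EuclideanSpace ℝ (Fin 3), ∃ r : ℝ, 0 < r ∧ ∃ M : ℝ,
      x ∈ K → ∀ t ∈ Ioo (T - r ^ 2) T, 0 < t → ∀ y ∈ ball x r, ‖u t y‖ ≤ M := by
    intro x
    by_cases hx : x ∈ K
    · obtain ⟨r, hr, M, hM⟩ := exists_bound_near_regularPoint hcl (hreg x hx)
      exact ⟨r, hr, M, fun _ => hM⟩
    · exact ⟨1, one_pos, 0, fun h => absurd h hx⟩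
  choose r hr M hM using hloc
  -- finite subcover of `K` by the balls `B(x, r x)`, centres in `K`
  obtain ⟨t, htK, hcov⟩ := hKc.elim_nhds_subcover (fun x => ball x (r x))
    (fun x _ => ball_mem_nhds x (hr x))
  -- depth and bound
  set D : Finset ℝ := insert 1 (t.image fun x => r x ^ 2) with hD
  have hDne : D.Nonempty := Finset.insert_nonempty _ _
  have hδpos : 0 < D.min' hDne := by
    refine (Finset.lt_min'_iff _ _).2 fun y hy => ?_
    rcases Finset.mem_insert.1 hy with rfl | hy
    · exact one_pos
    · obtain ⟨x, -, rfl⟩ := Finset.mem_image.1 hy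
      exact pow_pos (hr x) 2
  have hδle : ∀ x ∈ t, D.min' hDne ≤ r x ^ 2 := fun x hx =>
    Finset.min'_le _ _ (Finset.mem_insert_of_mem (Finset.mem_image_of_mem _ hx))
  set Bs : ℝ≥0 := t.sup fun x => (M x).toNNReal with hBs
  have hMle : ∀ x ∈ t, M x ≤ (Bs : ℝ) := fun x hx =>
    (Real.le_coe_toNNReal (M x)).trans (NNReal.coe_le_coe.2 (Finset.le_sup (f := fun x => (M x).toNNReal) hx))
  set T₁ : ℝ := max (max T₀ (T / 2)) (T - D.min' hDne) with hT₁
  have hT₁T : T₁ < T := max_lt (max_lt hT₀ (by linarith)) (by linarith)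
  refine ⟨max B₀ Bs, T₁, le_max_of_le_left hB₀, hT₁T, fun s hs x hx => ?_⟩
  have hs0 : 0 < s := by
    have := ((le_max_right T₀ (T / 2)).trans (le_max_left _ _)).trans_lt hs.1
    linarith
  have hsT₀ : s ∈ Ioo T₀ T := ⟨((le_max_left T₀ (T / 2)).trans (le_max_left _ _)).trans_lt hs.1, hs.2⟩
  by_cases hxR : R < ‖x‖
  · exact (hfar s hsT₀ x hxR).trans (le_max_left _ _)
  · -- `x ∈ K`, covered by some ball of the finite subcover
    have hxK : x ∈ K := ⟨by rw [mem_closedBall, dist_zero_right]; exact not_lt.1 hxR, hx⟩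
    obtain ⟨c, hc, hxc⟩ : ∃ c ∈ t, x ∈ ball c (r c) := by
      simpa only [mem_iUnion, exists_prop] using hcov hxK
    have hsc : s ∈ Ioo (T - r c ^ 2) T :=
      ⟨by linarith [hδle c hc, (le_max_right (max T₀ (T / 2)) (T - D.min' hDne)).trans_lt hs.1], hs.2⟩
    exact ((hM c (htK c hc) s hsc hs0 x hxc).trans (hMle c hc)).trans (le_max_right _ _)

/-! ## §3  The clause, and the crux, live on any neighbourhood of the singular set -/

/-- **The clause ⟺ the local clause on any neighbourhood of the time-`T` singular set.**  For a frame
solution, `ε > 0` and `0 ≤ q < 5`: `∫_{T₂}^T ‖u(t)‖₃^q dt < ∞` on some final window ⟺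
`∫_{T₂}^T (∫_{thickening ε Σ_T} |u(t)|³)^{q/3} dt < ∞` on some final window,
`Σ_T = {y : ¬ IsRegularPoint u (T,y)}`. -/
theorem jawClauseAt_iff_local_singularSet {ν T : ℝ} (hν : 0 < ν) (hT : 0 < T)
    {u : ℝ → EuclideanSpace ℝ (Fin 3) → EuclideanSpace ℝ (Fin 3)} {p : ℝ → EuclideanSpace ℝ (Fin 3) → ℝ}
    (hcl : IsClassicalNSSolutionOn (Ico 0 T) ν 0 u p) (hLH : IsLerayHopfOn T ν 0 (u 0) u)
    (hdec : HasRapidSpatialDecay (u 0)) {ε : ℝ} (hε : 0 < ε) {q : ℝ} (hq0 : 0 ≤ q) (hq5 : q < 5) :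
    (∃ T₂ ∈ Ioo 0 T, (∫⁻ t in Ioo T₂ T, eLpNorm (u t) 3 volume ^ q) < ⊤) ↔
      ∃ T₂ ∈ Ioo 0 T, (∫⁻ t in Ioo T₂ T,
        (∫⁻ x in thickening ε {y | ¬ IsRegularPoint u ((T, y) : ℝ × EuclideanSpace ℝ (Fin 3))},
          ‖u t x‖ₑ ^ 3) ^ (q / 3)) < ⊤ := by
  obtain ⟨B, T₁, hB, hT₁, hoff⟩ := bound_off_thickening_singularSet_of_frame hν hT hcl hLH hdec hε
  exact jawClauseAt_iff_local_of_bound_off hν hcl hLH hB hT₁ hoff hq0 hq5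

/-- **`L3CascadeJaw` ⟺ its localisation to the singular set (BY NAME, unconditional).**  The crux holds iff for
every `q ∈ (4,5)`, every frame solution and every `ε > 0` the local clause on the `ε`-neighbourhood of the
time-`T` singular set, `∫_{T₂}^T (∫_{thickening ε Σ_T} |u(t)|³)^{q/3} dt < ∞`, holds on a final window. -/
theorem l3CascadeJaw_iff_local_singularSet :
    L3CascadeJaw ↔
      ∀ q : ℝ, 4 < q → q < 5 → ∀ (ν T : ℝ), 0 < ν → 0 < T →
        ∀ (u : ℝ → EuclideanSpace ℝ (Fin 3) → EuclideanSpace ℝ (Fin 3)) (p : ℝ → EuclideanSpace ℝ (Fin 3) → ℝ),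
          IsClassicalNSSolutionOn (Ico 0 T) ν 0 u p → IsLerayHopfOn T ν 0 (u 0) u →
          HasRapidSpatialDecay (u 0) → ∀ ε : ℝ, 0 < ε →
            ∃ T₂ ∈ Ioo 0 T, (∫⁻ t in Ioo T₂ T,
              (∫⁻ x in thickening ε {y | ¬ IsRegularPoint u ((T, y) : ℝ × EuclideanSpace ℝ (Fin 3))},
                ‖u t x‖ₑ ^ 3) ^ (q / 3)) < ⊤ := by
  unfold L3CascadeJaw
  constructor
  · intro h q hq4 hq5 ν T hν hT u p hcl hLH hdec ε hε
    exact (jawClauseAt_iff_local_singularSet hν hT hcl hLH hdec hε (by linarith) hq5).1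
      (h q hq4 hq5 ν T hν hT u p hcl hLH hdec)
  · intro h q hq4 hq5 ν T hν hT u p hcl hLH hdec
    exact (jawClauseAt_iff_local_singularSet hν hT hcl hLH hdec one_pos (by linarith) hq5).2
      (h q hq4 hq5 ν T hν hT u p hcl hLH hdec 1 one_pos)

end Summit.NavierStokesRegularity.NavierStokesRegularity.Theorems.L3TimeExponentPincerJawSingularSetLocal

end
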